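import Summits.CriticalPhenomena.PercolationContinuityZ3.Theses.PercNonSelfAveraging

/-!
# `AnnulusLadder` — critical annulus non-crossing ⇒ lower tail of the critical arm mass

Route `PercNonSelfAveraging`, support item `stmt-CriticalPhenomena-7064`.

The statement: if there is `c > 0` such that for every `n ≥ 1` the critical (`p = p_c(ℤ³)`, bond)
probability that some site of `B(n)` is joined inside `B(2n)` to the inner vertex boundary of
`B(2n)` is at most `1 - c` (this antecedent is verbatim the crux `CritAnnulusNonCrossing` of route
`PercAnnulusCrossing`), then `ArmMassLowerTail` holds: for infinitely many `n`,
`P_{p_c}(M_n ≤ E M_n / 2) ≥ c`, where `M_n` is the arm mass of the box (number of sites of `B(n)`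
joined to `∂^{in} B(2n)` inside `B(2n)`).

Proof (pure measure theory, no percolation input): on the complement of the crossing event every
indicator in `M_n` vanishes, so `M_n = 0 ≤ E M_n / 2` (`E M_n ≥ 0` as an integral of a sum of
indicators); and `μ(Aᶜ) ≥ 1 - μ(A) ≥ c` by subadditivity (`measure_univ_le_add_compl`, no
measurability needed). This holds for every `n ≥ 1`, in particular frequently.

Sources: Grimmett 1999 §1.4 (events), the route file's item text.
-/

namespace Summit.CriticalPhenomena.PercolationContinuityZ3.Theorems

open MeasureTheory Filter Set

/-- Abstract core of the ladder: under a probability measure, if `μ(A) ≤ 1 - c` and the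
complement of `A` is contained in `T`, then `c ≤ μ(T)`.  No measurability is needed
(outer-measure subadditivity `μ(univ) ≤ μ(A) + μ(Aᶜ)`). -/
theorem percNonSelfAveraging_le_measureReal_of_compl_subset {Ω : Type*} [MeasurableSpace Ω]
    (μ : Measure Ω) [IsProbabilityMeasure μ] {A T : Set Ω} {c : ℝ}
    (hA : μ.real A ≤ 1 - c) (hsub : Aᶜ ⊆ T) : c ≤ μ.real T := by
  have h1 : (1 : ℝ) ≤ μ.real A + μ.real Aᶜ := by
    calc (1 : ℝ) = μ.real (Set.univ) := probReal_univ.symm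
      _ = μ.real (A ∪ Aᶜ) := by rw [Set.union_compl_self]
      _ ≤ μ.real A + μ.real Aᶜ := measureReal_union_le _ _
  have h2 : μ.real Aᶜ ≤ μ.real T := measureReal_mono hsub
  linarith

/-- **AnnulusLadder** (route `PercNonSelfAveraging`, item `stmt-CriticalPhenomena-7064`):
`CritAnnulusNonCrossing → ArmMassLowerTail`.  If for all `n ≥ 1` the critical probability of an
open crossing from `B(n)` to `∂^{in}B(2n)` inside `B(2n)` is at most `1 - c` (`c > 0`), then for
infinitely many (indeed all large) `n` the arm mass `M_n` satisfies
`P_{p_c}(M_n ≤ E_{p_c} M_n / 2) ≥ c`: on the non-crossing event `M_n = 0`. -/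
theorem annulusLadder_proof :
    Summit.CriticalPhenomena.PercolationContinuityZ3.Theses.PercNonSelfAveraging.AnnulusLadder := by
  unfold Summit.CriticalPhenomena.PercolationContinuityZ3.Theses.PercNonSelfAveraging.AnnulusLadder
    Summit.CriticalPhenomena.PercolationContinuityZ3.Theses.PercNonSelfAveraging.ArmMassLowerTail
  rintro ⟨c, hc, hbound⟩
  refine ⟨c, hc, ((Filter.eventually_ge_atTop 1).mono fun n hn => ?_).frequently⟩
  refine percNonSelfAveraging_le_measureReal_of_compl_subset _ (hbound n hn) fun ω hω => ?_
  simp only [Set.mem_compl_iff, Set.mem_setOf_eq, not_exists, not_and] at hω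
  simp only [Set.mem_setOf_eq]
  have hzero : ∀ x ∈ Literature.Probability.LatticeModels.box 3 n,
      Set.indicator {ω' | ∃ y ∈ Literature.Probability.LatticeModels.innerBoundary
        (Literature.Probability.LatticeModels.zdGraph 3)
        (Literature.Probability.LatticeModels.box 3 (2 * n)),
        ω' ∈ Literature.Probability.Percolation.openConnIn
          ↑(Literature.Probability.LatticeModels.box 3 (2 * n)) x y} (fun _ => (1 : ℝ)) ω = 0 := by
    intro x hx
    apply Set.indicator_of_notMem
    simp only [Set.mem_setOf_eq, not_exists, not_and]
    exact fun y hy hconn => hω x hx y hy hconn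
  rw [Finset.sum_eq_zero hzero]
  refine div_nonneg (integral_nonneg fun ω' => ?_) two_pos.le
  exact Finset.sum_nonneg fun x _ => Set.indicator_nonneg (fun _ _ => zero_le_one) _

end Summit.CriticalPhenomena.PercolationContinuityZ3.Theorems
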